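import Summits.QuantumFields.YangMills.Theorems.BalabanUVNodesN08HaarCompatibilityGuardChartLift
import Summits.QuantumFields.YangMills.Theorems.BalabanUVNodesN08HaarCompatibilityGuardOneWindow
import Summits.QuantumFields.YangMills.Theorems.BalabanUVNodesN08HaarCompatibilityGuardCoerciveWindows
import Summits.QuantumFields.YangMills.Theorems.BalabanUVNodesN08HaarCompatibilityGuardCoreKmatDictionary
import Summits.QuantumFields.YangMills.Theorems.BalabanUVNodesN08HaarCompatibilityGuardFibreCore
import Literature.MathematicalPhysics.QuantumFieldTheory.Balaban1983to89.B15Prop1ChartCalculusSU2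

/-!
# BalabanUVNodes ∕ N08 — THE CHART CONJUGATE OF THE PRINTED CORE MAP AT `N = 2`: with the target chart centred at the SAME point `w₀` the conjugate
# `ψ(A) = rev(imVec(qlog(ū₀·k(u₀e^{ι(rev A)}))))` is differentiable on the window with a NORM FLOOR `κ₀‖h‖ ≤ ‖ψ′(A)h‖`, and conjugates the core map

WIDTH SEAT `pub-ymgap-dag-n08-w3` g5, `W-SEAT-START-LIST.md` §0 (iii); item-3 lineage part 27B = (E3b) of `N08-EML-JACOBIAN.md` §7, the piece named in part 25
p621260's WHAT IS LEFT («the chart conjugate ψc of the printed core map … its differentiability through the chart and the floor m»), 2026-08-28.  DAG node N08 =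
[Balaban1985UV3] Thm 1 p. 257 + Thm 2 p. 272; [Balaban1987RG1] (0.4) p. 253; key item K1⁷ `StabilityBAtRecordR13SepCoPH` (stmt-QuantumFields-20542, `aside`),
`--supports … --as helper`.  COUNT-NEUTRAL.  Consumed by part 27C `…GuardCoreLawSU2` ((H_K-core) ∕ (H_K) at `N = 2`).

WHAT THIS FILE PROVES (theorems only, 0 def; [folklore] calculus in pub-balaban's quaternion model — `qlog`, `kf`, `kD`, `Yf`, `imQuat`, `imVec(L)`, `rev` BY
IMPORT; parts 26A∕26B∕27A of this lineage):
 * `norm_imVec_of_re_eq_zero`, `imQuat_imVec_of_re_eq_zero` (the imaginary-vector coordinates are isometric ∕ invertible on `Im ℍ`);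
 * `norm_Yf_le_of_guard`: on the `SU(2)` guard `‖aᵢū − 1‖ < 1∕3`, `‖Y(u)‖ ≤ (7∕20)·Σcᵢ` (each `‖qlog(aᵢū)‖ < 7∕20` by part 26A, `1∕3 ≤ sin(7∕20)`);
 * ★ `norm_target_sub_one_lt`: **THE IMAGE STAYS IN THE SERIES-LOG BALL WHEN THE TARGET CHART IS CENTRED AT `w₀` ITSELF** — for a unit `w` with `‖w − u₀‖ < 2∕3` in
   the guard and `Σcᵢ ≤ 8∕9`: `v = ū₀·k(w)` is a unit with `‖v − 1‖ ≤ ‖Y(w)‖ + ‖w − u₀‖ < (7∕20)(8∕9) + 2∕3 < 1` (crude Lipschitz bounds; this is where the range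
   `Σcᵢ ≤ 8∕9` enters);
 * ★★★ `exists_hasFDerivAt_chart`: for `‖A‖ < π∕3` with `w = u₀e^{ι(rev A)}` guarded and `2∕3`-close to `u₀`, the conjugate `ψ` HAS A FRÉCHET DERIVATIVE `D` AT `A`
   (chain rule: `rev`, `imQuat`, `hasFDerivAt_exp`, left translations, pub-balaban's `hasStrictFDerivAt_kf`, `hasFDerivAt_qlog` on `‖v − 1‖ < 1`, `imVecL`, `rev`)
   WITH **`κ₀‖h‖ ≤ ‖D h‖`, `κ₀ = (1 − Σcᵢ)·sin 1·(sin(π∕3)∕(π∕3))`** — the composite applied to `h` is `rev(imVec(N_{qlog v} y₂))` where `D exp(B)(ιrev h) = e^B y₁`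
   (`‖y₁‖ ≥ sinc‖B‖·‖h‖`, 27A), `k′(w)(w y₁) = k(w) y₂` (`‖y₂‖ ≥ (1−Σcᵢ) sinc‖Y‖·‖y₁‖`, 27A's quaternion tangent floor), `D qlog(v)(v y₂) = N_{qlog v} y₂`
   (`‖·‖ ≥ ‖y₂‖`, 27A), with `sinc‖Y‖ ≥ sin 1` (`‖Y‖ ≤ 1`) and `sinc‖B‖ ≥ sin(π∕3)∕(π∕3)` (`‖B‖ = ‖A‖ < π∕3`);
 * ★ `chart_conj`: `u₀·e^{ι(rev(ψ A))} = k(w)` (`exp ∘ qlog = id`) and `‖ψ A‖ < π∕3` (27A `norm_qlog_lt_pi_div_three`).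
HONEST FRAMING: quaternion-level lemmas; the `SU(2)` assembly ((H_K-core), (H_K), part 20's bound at the slot) is part 27C; E6′ NOT decided; `hmass` NOT supplied;
count-neutral; N08 NOT discharged; counts unmoved (typed 28∕28 · discharged 5∕27); R4 closes the CONDITIONAL rung `BalabanLadder.UV` only; the Yang–Mills
mass gap (Clay) is NOT proved; nothing continuum ∕ OS.  0 `sorry`, standard axioms.
-/

noncomputable section

open NormedSpace Set Metric Function Filter MeasureTheory
open scoped RealInnerProductSpace Topology Quaternion ENNReal

namespace Summit.QuantumFields.YangMills.BalabanUVNodes.N08HaarCompatibilityGuardCoreChart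

open Literature.MathematicalPhysics.QuantumFieldTheory (haarProbability)
open Literature.MathematicalPhysics.QuantumFieldTheory.Balaban1983to89
open Literature.MathematicalPhysics.QuantumFieldTheory.Balaban1983to89.T4QuatExpLog
open Literature.MathematicalPhysics.QuantumFieldTheory.Balaban1983to89.T4EMLFibreAC
open Literature.MathematicalPhysics.QuantumFieldTheory.Balaban1983to89.T4HaarSU2ExpChart (imQuat imQuat_re norm_imQuat expPoint
  su2Quat_expPoint injOn_expPoint)
open Literature.MathematicalPhysics.QuantumFieldTheory.Balaban1983to89.T4ExpWindowSmallField (imVec imQuat_imVec norm_imVec_sq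
  dist1_eq_norm_su2Quat_sub_one)
open Literature.MathematicalPhysics.QuantumFieldTheory.Balaban1983to89.B15Prop1ChartCalculusSU2 (imVecL imVecL_apply imVec_imQuat)
open Literature.MathematicalPhysics.QuantumFieldTheory.Balaban1983to89.B10Eq18SigmaSU2Haar (rev rev_rev norm_rev expPauli expPauli_eq_expPoint)
open Literature.MathematicalPhysics.QuantumFieldTheory.Balaban1983to89.B10Eq22Rescaling (sigmaSU2)
open Literature.MathematicalPhysics.QuantumLattice (quatMatrix su2Quat norm_su2Quat quatToSU2 quatToSU2_su2Quat quatMatrix_su2Quat)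
open Literature.MathematicalPhysics.QuantumFieldTheory.Balaban1983to89.T4HaarSU2Translate (su2Quat_mul haarData_haar_eq)
open Summit.QuantumFields.YangMills.BalabanUVNodes.N08HaarCompatibilityGuardGeodesics
open Summit.QuantumFields.YangMills.BalabanUVNodes.N08HaarCompatibilityGuardCoreInjective
open Summit.QuantumFields.YangMills.BalabanUVNodes.N08HaarCompatibilityGuardChartLift

/-! ## §1 Quaternion-level chart lemmas -/

section Quat

variable {ι : Type*} [Fintype ι]

/-- `imVec` of an imaginary quaternion has the same norm. [folklore] -/
theorem norm_imVec_of_re_eq_zero {q : ℍ} (hq : q.re = 0) : ‖imVec q‖ = ‖q‖ := by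
  have h1 : ‖imVec q‖ ^ 2 = ‖q‖ ^ 2 := by
    rw [norm_imVec_sq, sq ‖q‖, ← Quaternion.normSq_eq_norm_mul_self, Quaternion.normSq_def', hq]
    ring
  exact (pow_left_inj₀ (norm_nonneg _) (norm_nonneg _) two_ne_zero).1 h1

/-- `imQuat (imVec q) = q` for imaginary `q`. [folklore] -/
theorem imQuat_imVec_of_re_eq_zero {q : ℍ} (hq : q.re = 0) : imQuat (imVec q) = q := by
  rw [imQuat_imVec]
  ext <;> simp [hq]

/-- The exponent is small on the `SU(2)` guard: `‖aᵢū − 1‖ < 1∕3` for all `i` (unit `aᵢ, u`, `cᵢ ≥ 0`) ⇒ `‖Y(u)‖ ≤ (7∕20)·Σcᵢ`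
(each `‖qlog(aᵢū)‖ < 7∕20` since `1∕3 ≤ sin(7∕20)`; part 26A `norm_qlog_lt_of_chord`). [folklore] -/
theorem norm_Yf_le_of_guard {a : ι → ℍ} (c : ι → ℝ) {u : ℍ} (hu : ‖u‖ = 1) (ha : ∀ i, ‖a i‖ = 1) (hc : ∀ i, 0 ≤ c i)
    (hg : ∀ i, ‖a i * star u - 1‖ < 1 / 3) : ‖Yf a c u‖ ≤ 7 / 20 * ∑ i, c i := by
  have hsin : (1 / 3 : ℝ) ≤ Real.sin (7 / 20) := by
    have := Real.sin_gt_sub_cube (show (0:ℝ) < 7/20 by norm_num); nlinarith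
  rw [Yf, Finset.mul_sum]
  refine (norm_sum_le _ _).trans (Finset.sum_le_sum fun i _ => ?_)
  have hW1 : ‖a i * star u‖ = 1 := by simp [norm_mul, ha i, hu]
  have hZ : ‖qlog (a i * star u)‖ < 7 / 20 := norm_qlog_lt_of_chord hW1 (hg i) hsin (by norm_num) (by norm_num)
  rw [norm_smul, Real.norm_of_nonneg (hc i), mul_comm (7 / 20 : ℝ)]
  exact mul_le_mul_of_nonneg_left hZ.le (hc i)

/-- **The image stays in the log ball** (target chart centred at the SAME point `u₀`): for a unit `u₀`, a unit `w` with `‖w − u₀‖ < 2∕3` in the guard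
`‖aᵢw̄ − 1‖ < 1∕3`, and `Σcᵢ ≤ 8∕9`: `v := ū₀·k(w)` is a unit with `‖v − 1‖ < 1` (`‖k(w) − u₀‖ ≤ ‖e^{Y(w)} − 1‖ + ‖w − u₀‖ ≤ (7∕20)(8∕9) + 2∕3 < 1`). [folklore] -/
theorem norm_target_sub_one_lt {a : ι → ℍ} (c : ι → ℝ) {u₀ w : ℍ} (hu₀ : ‖u₀‖ = 1) (hw : ‖w‖ = 1) (ha : ∀ i, ‖a i‖ = 1) (hc : ∀ i, 0 ≤ c i)
    (hs : ∑ i, c i ≤ 8 / 9) (hg : ∀ i, ‖a i * star w - 1‖ < 1 / 3) (hwu : ‖w - u₀‖ < 2 / 3) :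
    ‖star u₀ * kf a c w‖ = 1 ∧ ‖star u₀ * kf a c w - 1‖ < 1 := by
  have hYre : (Yf a c w).re = 0 := Yf_re_eq_zero c hw ha hc (by linarith) (fun i => (hg i).trans (by norm_num))
  have hk1 : ‖kf a c w‖ = 1 := by rw [kf, norm_mul, norm_exp_of_re_eq_zero hYre, hw, mul_one]
  have hus : u₀ * star u₀ = 1 := by rw [Quaternion.self_mul_star, Quaternion.normSq_eq_norm_mul_self, hu₀]; simp
  refine ⟨by rw [norm_mul, Quaternion.norm_star, hu₀, hk1, one_mul], ?_⟩
  have h1 : star u₀ * kf a c w - 1 = star u₀ * (kf a c w - u₀) := by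
    rw [mul_sub]
    have : star u₀ * u₀ = 1 := by rw [Quaternion.star_mul_self, Quaternion.normSq_eq_norm_mul_self, hu₀]; simp
    rw [this]
  rw [h1, norm_mul, Quaternion.norm_star, hu₀, one_mul]
  have h2 : kf a c w - u₀ = (exp (Yf a c w) - 1) * w + (w - u₀) := by rw [kf, sub_mul, one_mul]; abel
  have hY := norm_Yf_le_of_guard c hw ha hc hg
  calc ‖kf a c w - u₀‖ ≤ ‖(exp (Yf a c w) - 1) * w‖ + ‖w - u₀‖ := by rw [h2]; exact norm_add_le _ _
    _ = ‖exp (Yf a c w) - 1‖ + ‖w - u₀‖ := by rw [norm_mul, hw, mul_one]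
    _ ≤ ‖Yf a c w‖ + ‖w - u₀‖ := by gcongr; exact norm_exp_sub_one_le hYre
    _ < 7 / 20 * (8 / 9) + 2 / 3 := by
        have : ‖Yf a c w‖ ≤ 7 / 20 * (8 / 9) := hY.trans (by nlinarith)
        linarith
    _ < 1 := by norm_num

/-- ★★ **THE CHART CONJUGATE AND ITS DERIVATIVE WITH A NORM FLOOR.**  For unit `aᵢ`, `cᵢ ≥ 0` with `Σcᵢ ≤ 8∕9`, a unit `u₀`, and `A ∈ ℝ³` with `‖A‖ < π∕3`
such that `w = u₀·e^{ι(rev A)}` is in the guard `‖aᵢw̄ − 1‖ < 1∕3` and `‖w − u₀‖ < 2∕3`, the chart conjugate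
`ψ(A) = rev(imVec(qlog(ū₀·k(u₀ e^{ι(rev A)}))))` has a Fréchet derivative `D` at `A` with **`κ₀‖h‖ ≤ ‖D h‖`**,
`κ₀ = (1 − Σcᵢ)·sin 1·(sin(π∕3)∕(π∕3))` (chain rule; lower singular values `sinc‖ιA‖ ≥ sinc(π∕3)` of `D exp`, `(1 − Σcᵢ)sinc‖Y‖ ≥ (1 − Σcᵢ) sin 1` of
`k′` (part 27A `exists_kD_mul_eq`), `1` of `D qlog` (`norm_le_norm_N`); left translations, `ι = imQuat∘rev` and `rev∘imVec` are isometric on the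
relevant imaginary vectors). [folklore] -/
theorem exists_hasFDerivAt_chart {a : ι → ℍ} (c : ι → ℝ) {u₀ : ℍ} (hu₀ : ‖u₀‖ = 1) (ha : ∀ i, ‖a i‖ = 1) (hc : ∀ i, 0 ≤ c i)
    (hs : ∑ i, c i ≤ 8 / 9) {A : EuclideanSpace ℝ (Fin 3)} (hA : ‖A‖ < Real.pi / 3)
    (hg : ∀ i, ‖a i * star (u₀ * exp (imQuat (rev A))) - 1‖ < 1 / 3) (hwu : ‖u₀ * exp (imQuat (rev A)) - u₀‖ < 2 / 3) :
    ∃ D : EuclideanSpace ℝ (Fin 3) →L[ℝ] EuclideanSpace ℝ (Fin 3),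
      HasFDerivAt (fun A : EuclideanSpace ℝ (Fin 3) => rev (imVec (qlog (star u₀ * kf a c (u₀ * exp (imQuat (rev A))))))) D A ∧
      ∀ h, ((1 - ∑ i, c i) * Real.sin 1 * (Real.sin (Real.pi / 3) / (Real.pi / 3))) * ‖h‖ ≤ ‖D h‖ := by
  set B : ℍ := imQuat (rev A) with hB_def
  set w : ℍ := u₀ * exp B with hw_def
  set v : ℍ := star u₀ * kf a c w with hv_def
  have hBre : B.re = 0 := imQuat_re _
  have hBn : ‖B‖ = ‖A‖ := by rw [hB_def, norm_imQuat, norm_rev]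
  have hw1 : ‖w‖ = 1 := by rw [hw_def, norm_mul, hu₀, norm_exp_of_re_eq_zero hBre, mul_one]
  obtain ⟨hv1, hv⟩ := norm_target_sub_one_lt c hu₀ hw1 ha hc hs hg hwu
  have hs1 : ∑ i, c i ≤ 1 := hs.trans (by norm_num)
  have hg2 : ∀ i, ‖a i * star w - 1‖ < 1 / 2 := fun i => (hg i).trans (by norm_num)
  have hg1 : ∀ i, ‖a i * star w - 1‖ < 1 := fun i => (hg i).trans (by norm_num)
  -- the chain of derivatives
  set I : EuclideanSpace ℝ (Fin 3) →L[ℝ] ℍ := (imQuat.toContinuousLinearMap).comp (rev.toContinuousLinearEquiv : EuclideanSpace ℝ (Fin 3) →L[ℝ] EuclideanSpace ℝ (Fin 3)) with hI_def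
  have hI : ∀ h, I h = imQuat (rev h) := fun h => rfl
  have hIder : HasFDerivAt (fun A : EuclideanSpace ℝ (Fin 3) => imQuat (rev A)) I A := by
    have := I.hasFDerivAt (x := A)
    exact this
  have hE : HasFDerivAt (fun A : EuclideanSpace ℝ (Fin 3) => u₀ * exp (imQuat (rev A)))
      ((ContinuousLinearMap.mul ℝ ℍ u₀).comp ((fderiv ℝ exp B).comp I)) A := by
    have h1 := (hasFDerivAt_exp B).comp A hIder
    exact h1.const_mul u₀
  have hK : HasFDerivAt (kf a c) (kD a c w) w := (hasStrictFDerivAt_kf c hg1).hasFDerivAt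
  have hKE := hK.comp A hE
  have hV : HasFDerivAt (fun A : EuclideanSpace ℝ (Fin 3) => star u₀ * kf a c (u₀ * exp (imQuat (rev A))))
      ((ContinuousLinearMap.mul ℝ ℍ (star u₀)).comp ((kD a c w).comp ((ContinuousLinearMap.mul ℝ ℍ u₀).comp ((fderiv ℝ exp B).comp I)))) A :=
    hKE.const_mul (star u₀)
  have hL : HasFDerivAt qlog (fderiv ℝ qlog v) v := hasFDerivAt_qlog hv
  have hLV := hL.comp A hV
  set P : ℍ →L[ℝ] EuclideanSpace ℝ (Fin 3) := (rev.toContinuousLinearEquiv : EuclideanSpace ℝ (Fin 3) →L[ℝ] EuclideanSpace ℝ (Fin 3)).comp imVecL with hP_def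
  have hP : ∀ q, P q = rev (imVec q) := fun q => rfl
  have hfull := P.hasFDerivAt.comp A hLV
  refine ⟨P.comp ((fderiv ℝ qlog v).comp ((ContinuousLinearMap.mul ℝ ℍ (star u₀)).comp ((kD a c w).comp
    ((ContinuousLinearMap.mul ℝ ℍ u₀).comp ((fderiv ℝ exp B).comp I))))), hfull, ?_⟩
  -- the norm floor
  intro h
  set x : ℍ := imQuat (rev h) with hx_def
  have hxre : x.re = 0 := imQuat_re _
  have hxn : ‖x‖ = ‖h‖ := by rw [hx_def, norm_imQuat, norm_rev]
  -- step 1: `D exp(B) x = e^B y₁`, `y₁` imaginary, `‖y₁‖ ≥ sinc‖B‖·‖x‖`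
  set t₁ : ℍ := fderiv ℝ exp B x with ht₁_def
  set y₁ : ℍ := exp (-B) * t₁ with hy₁_def
  have hy₁re : y₁.re = 0 := re_exp_neg_mul_fderiv_exp hBre hxre
  have ht₁ : t₁ = exp B * y₁ := by rw [hy₁_def, ← mul_assoc, exp_mul_exp_neg, one_mul]
  have hy₁n : |Real.sinc ‖B‖| * ‖x‖ ≤ ‖y₁‖ := by
    have : ‖y₁‖ = ‖t₁‖ := by
      have hnB : (-B).re = 0 := by rw [Quaternion.re_neg, hBre, neg_zero]
      rw [hy₁_def, norm_mul, norm_exp_of_re_eq_zero hnB, one_mul]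
    rw [this]; exact abs_sinc_mul_norm_le_norm_fderiv_exp hBre hxre
  -- step 2: `k′(w)(w y₁) = k(w) y₂`
  obtain ⟨y₂, hy₂re, hy₂, hy₂n⟩ := exists_kD_mul_eq c hw1 ha hc hs1 hg2 hy₁re
  -- step 3: `D qlog(v)(v y₂) = N_{qlog v} y₂`
  have hq := fderiv_qlog_apply_mul_of_lt_one hv1 hv hy₂re
  have hZre : (qlog v).re = 0 := qlog_re_of_norm_eq_one hv1 hv
  have hZπ : ‖qlog v‖ < Real.pi := (norm_qlog_lt_pi_div_three hv1 hv).trans (by linarith [Real.pi_gt_three])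
  have hNre : (N (qlog v) y₂).re = 0 := N_re hZre hy₂re
  -- the composite applied to `h`
  have hcomp : (P.comp ((fderiv ℝ qlog v).comp ((ContinuousLinearMap.mul ℝ ℍ (star u₀)).comp ((kD a c w).comp
      ((ContinuousLinearMap.mul ℝ ℍ u₀).comp ((fderiv ℝ exp B).comp I)))))) h = rev (imVec (N (qlog v) y₂)) := by
    simp only [ContinuousLinearMap.comp_apply, ContinuousLinearMap.mul_apply', hI, hP]
    rw [← hx_def, ← ht₁_def, ht₁, ← mul_assoc, ← hw_def, hy₂, ← mul_assoc, ← hv_def, hq]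
  rw [hcomp, norm_rev, norm_imVec_of_re_eq_zero hNre]
  -- collect the floors
  have hN : ‖y₂‖ ≤ ‖N (qlog v) y₂‖ := norm_le_norm_N hZre hy₂re hZπ
  have hsl : 0 ≤ 1 - ∑ i, c i := by linarith
  -- `sinc‖Y‖ ≥ sin 1` and `|sinc‖B‖| ≥ sin(π/3)/(π/3)`
  have hYre : (Yf a c w).re = 0 := Yf_re_eq_zero c hw1 ha hc hs1 hg2
  have hY1 : ‖Yf a c w‖ ≤ 1 := by
    have := norm_Yf_le_of_guard c hw1 ha hc hg; nlinarith [Finset.sum_nonneg fun i (_ : i ∈ Finset.univ) => hc i]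
  have hsincY : Real.sin 1 ≤ Real.sinc ‖Yf a c w‖ := by
    rcases eq_or_ne ‖Yf a c w‖ 0 with h0 | h0
    · rw [h0, Real.sinc_zero]; exact Real.sin_le_one 1
    · rw [Real.sinc_of_ne_zero h0]
      have hpos : 0 < ‖Yf a c w‖ := (norm_nonneg _).lt_of_ne' h0
      have := N08HaarCompatibilityGuardJacobian.sin_div_le_sin_div hpos hY1 (by linarith [Real.pi_gt_three])
      simpa using this
  have hsincB : Real.sin (Real.pi / 3) / (Real.pi / 3) ≤ |Real.sinc ‖B‖| := by
    rw [hBn]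
    rcases eq_or_ne ‖A‖ 0 with h0 | h0
    · rw [h0, Real.sinc_zero, abs_one]
      exact (div_le_one (by positivity)).2 ((Real.sin_le (by positivity)).trans le_rfl)
    · have hpos : 0 < ‖A‖ := (norm_nonneg _).lt_of_ne' h0
      rw [Real.sinc_of_ne_zero h0, abs_of_nonneg (div_nonneg (Real.sin_nonneg_of_nonneg_of_le_pi hpos.le (by linarith [Real.pi_gt_three])) hpos.le)]
      exact N08HaarCompatibilityGuardJacobian.sin_div_le_sin_div hpos hA.le (by linarith [Real.pi_gt_three])
  have hsin1 : 0 ≤ Real.sin 1 := Real.sin_nonneg_of_nonneg_of_le_pi zero_le_one (by linarith [Real.pi_gt_three])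
  have hsin3 : 0 ≤ Real.sin (Real.pi / 3) / (Real.pi / 3) :=
    div_nonneg (Real.sin_nonneg_of_nonneg_of_le_pi (by positivity) (by linarith [Real.pi_gt_three])) (by positivity)
  calc (1 - ∑ i, c i) * Real.sin 1 * (Real.sin (Real.pi / 3) / (Real.pi / 3)) * ‖h‖
      ≤ (1 - ∑ i, c i) * Real.sinc ‖Yf a c w‖ * |Real.sinc ‖B‖| * ‖h‖ :=
        mul_le_mul_of_nonneg_right (mul_le_mul (mul_le_mul_of_nonneg_left hsincY hsl) hsincB hsin3
          (mul_nonneg hsl (hsin1.trans hsincY))) (norm_nonneg h)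
    _ = (1 - ∑ i, c i) * Real.sinc ‖Yf a c w‖ * (|Real.sinc ‖B‖| * ‖x‖) := by rw [hxn]; ring
    _ ≤ (1 - ∑ i, c i) * Real.sinc ‖Yf a c w‖ * ‖y₁‖ := by
        have : 0 ≤ (1 - ∑ i, c i) * Real.sinc ‖Yf a c w‖ := mul_nonneg hsl (hsin1.trans hsincY)
        exact mul_le_mul_of_nonneg_left hy₁n this
    _ ≤ ‖y₂‖ := hy₂n
    _ ≤ ‖N (qlog v) y₂‖ := hN

/-- **THE CONJUGACY AND THE RANGE**: with `v = ū₀·k(w)` as above, `u₀·e^{ι(rev(ψ A))} = k(w)` and `‖ψ A‖ < π∕3`. [folklore] -/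
theorem chart_conj {a : ι → ℍ} (c : ι → ℝ) {u₀ w : ℍ} (hu₀ : ‖u₀‖ = 1) (hw : ‖w‖ = 1) (ha : ∀ i, ‖a i‖ = 1) (hc : ∀ i, 0 ≤ c i)
    (hs : ∑ i, c i ≤ 8 / 9) (hg : ∀ i, ‖a i * star w - 1‖ < 1 / 3) (hwu : ‖w - u₀‖ < 2 / 3) :
    u₀ * exp (imQuat (rev (rev (imVec (qlog (star u₀ * kf a c w)))))) = kf a c w ∧
      ‖rev (imVec (qlog (star u₀ * kf a c w)))‖ < Real.pi / 3 := by
  obtain ⟨hv1, hv⟩ := norm_target_sub_one_lt c hu₀ hw ha hc hs hg hwu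
  have hZre : (qlog (star u₀ * kf a c w)).re = 0 := qlog_re_of_norm_eq_one hv1 hv
  have hus : u₀ * star u₀ = 1 := by rw [Quaternion.self_mul_star, Quaternion.normSq_eq_norm_mul_self, hu₀]; simp
  refine ⟨?_, ?_⟩
  · rw [rev_rev, imQuat_imVec_of_re_eq_zero hZre, exp_qlog hv, ← mul_assoc, hus, one_mul]
  · rw [norm_rev, norm_imVec_of_re_eq_zero hZre]; exact norm_qlog_lt_pi_div_three hv1 hv

end Quat

end Summit.QuantumFields.YangMills.BalabanUVNodes.N08HaarCompatibilityGuardCoreChart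

end
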